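import Mathlib
import Literature.AlgebraicGeometry.Tropical.TropicalLink
import Summits.ResolutionOfSingularities.ResolutionOfSingularities.Theorems.TropicalLinksInductiveStepRayFibreRange
import Summits.ResolutionOfSingularities.ResolutionOfSingularities.Theorems.TropicalLinksInductiveStepStratumChart

/-!
# TropicalLinks / InductiveStep — a valuation centred at a point of the ray fibre (brick E)

Route `ResolutionOfSingularities/TropicalLinks`, crux `InductiveStep` (stmt-ResolutionOfSingularities-17233),
line `split`, brick E of the valuative layer, in support of
`tropicalLinks_isSchonIdeal_of_valuativeCharts`.

Informal statement.  Let `J ⊆ k[ℤ × K] = k[x₁^±, y^±]` be a prime ideal, `𝒪' = k[ℤ × K] ⧸ J` the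
coordinate ring of the very affine variety `V(J)` (a domain) and `B ⊆ 𝒪'` the image of
`k[ℕ × K] = k[x₁, y^±]`, the coordinate ring of the partial compactification of `V(J)` along the ray
`x₁`.  If the special fibre is non-empty — the fibre ring `k[K] ⧸ linkIdeal inr ((J ∩ k[ℕ × K]) + (x₁))`
is not the zero ring — then there is a valuation `v` of `𝒪'` with trivial support, `≤ 1` on `B`
(equivalently: on the constants `k` and on every torus monomial `x^w` with `w.1 ≥ 0`) and `< 1` on `x₁`:
a valuation of the function field centred at a point of the special fibre.

Proof.  By brick G0 (`tropicalLinks_nonempty_rayFibre_algEquiv_range_quotient`) the fibre ring is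
`≅ B ⧸ (x₁)`, so `(x₁) ≠ B`, i.e. `x₁` is not a unit of `B`.  Push `B` into the fraction field `L` of
`𝒪'`; the principal ideal generated by `x₁` in the image is still proper, so by
`Ideal.image_subset_nonunits_valuationSubring` (every local subring of a field is dominated by a
valuation subring) there is a valuation subring `V ⊆ L` containing `B` with `x₁` a non-unit of `V`.  The
valuation of `V`, pulled back to `𝒪'`, does the job.  No new definitions.
-/

-- single-problem summit: the doubled namespace component `ResolutionOfSingularities` is forced
set_option linter.dupNamespace false

namespace Summit.ResolutionOfSingularities.ResolutionOfSingularities.Theorems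

open AddMonoidAlgebra Literature.AlgebraicGeometry.Tropical

/-- **A valuation centred at a point of the ray fibre** (brick E of the valuative layer).  For a prime
ideal `J ⊆ k[ℤ × K]` whose ray fibre ring `k[K] ⧸ linkIdeal inr ((J ∩ k[ℕ × K]) + (x₁))` is not the zero
ring, there is a valuation `v` of `k[ℤ × K] ⧸ J` with trivial support which is `≤ 1` on every torus
monomial `x^w` with `w.1 ≥ 0` and on the constants, and `< 1` on `x₁`. [folklore] -/
theorem tropicalLinks_exists_valuation_of_rayFibre : ∀ (k : Type) [Field k] (K : Type) [AddCommGroup K] (J : Ideal (AddMonoidAlgebra k (ℤ × K))), J.IsPrime → ¬ Subsingleton (AddMonoidAlgebra k K ⧸ Literature.AlgebraicGeometry.Tropical.linkIdeal (AddMonoidHom.inr ℕ K) (Literature.AlgebraicGeometry.Tropical.linkIdeal ((Nat.castAddMonoidHom ℤ).prodMap (AddMonoidHom.id K)) J ⊔ Ideal.span {AddMonoidAlgebra.single ((1 : ℕ), (0 : K)) (1 : k)})) → ∃ (Γ₀ : Type) (_ : LinearOrderedCommGroupWithZero Γ₀) (v : Valuation (AddMonoidAlgebra k (ℤ × K) ⧸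 J) Γ₀), v.supp = ⊥ ∧ (∀ w : ℤ × K, 0 ≤ w.1 → v (Ideal.Quotient.mk J (AddMonoidAlgebra.single w (1 : k))) ≤ 1) ∧ (∀ c : k, v (algebraMap k (AddMonoidAlgebra k (ℤ × K) ⧸ J) c) ≤ 1) ∧ v (Ideal.Quotient.mk J (AddMonoidAlgebra.single ((1 : ℤ), (0 : K)) (1 : k))) < 1 := by
  intro k _ K _ J hJ hns
  haveI : IsDomain (AddMonoidAlgebra k (ℤ × K) ⧸ J) := Ideal.Quotient.isDomain J
  -- the generator `x₁` of the fibre ideal and the image `B` of the partial compactification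
  set x₁ : AddMonoidAlgebra k (ℤ × K) ⧸ J :=
    Ideal.Quotient.mk J (single ((1 : ℤ), (0 : K)) (1 : k)) with hx₁
  set B : Subalgebra k (AddMonoidAlgebra k (ℤ × K) ⧸ J) := ((Ideal.Quotient.mkₐ k J).comp
    (AddMonoidAlgebra.mapDomainAlgHom k k ((Nat.castAddMonoidHom ℤ).prodMap (AddMonoidHom.id K)))).range
    with hB
  have hxB : ∀ w : ℤ × K, 0 ≤ w.1 → Ideal.Quotient.mk J (single w (1 : k)) ∈ B := by
    intro w hw
    rw [hB]
    exact tropicalLinks_mk_single_mem_range_of_fst_nonneg J hw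
  have hcB : ∀ c : k, algebraMap k (AddMonoidAlgebra k (ℤ × K) ⧸ J) c ∈ B := fun c => B.algebraMap_mem c
  have hx₁B : x₁ ∈ B := hxB ((1 : ℤ), (0 : K)) zero_le_one
  -- brick G0: the fibre ring is `B ⧸ (x₁)`
  obtain ⟨eG0⟩ := tropicalLinks_nonempty_rayFibre_algEquiv_range_quotient k K J B hB
  clear_value B
  -- hence `(x₁) ≠ B`, i.e. `x₁` is not a unit of `B`
  have hne_top : Ideal.span {x : ↥B | (x : AddMonoidAlgebra k (ℤ × K) ⧸ J) = x₁} ≠ ⊤ := by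
    intro htop
    haveI := Ideal.Quotient.subsingleton_iff.mpr htop
    exact hns eG0.toEquiv.subsingleton
  have hx₁nu : ¬ IsUnit (⟨x₁, hx₁B⟩ : ↥B) := fun hu =>
    hne_top (Ideal.eq_top_of_isUnit_mem _ (Ideal.subset_span rfl) hu)
  -- push everything into the fraction field `L` of the domain `𝒪' = k[ℤ × K] ⧸ J`
  let L := FractionRing (AddMonoidAlgebra k (ℤ × K) ⧸ J)
  let alg : (AddMonoidAlgebra k (ℤ × K) ⧸ J) →+* L := algebraMap _ L
  have halg : Function.Injective alg := IsFractionRing.injective _ _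
  let Bs : Subring L := B.toSubring.map alg
  have hx₁Bs : alg x₁ ∈ Bs := ⟨x₁, hx₁B, rfl⟩
  -- the principal ideal `(x₁)` of the image of `B` is proper
  have hI₁ : Ideal.span {(⟨alg x₁, hx₁Bs⟩ : ↥Bs)} ≠ ⊤ := by
    intro htop
    rw [Ideal.eq_top_iff_one, Ideal.mem_span_singleton] at htop
    obtain ⟨⟨b, hb⟩, hb1⟩ := htop
    obtain ⟨b', hb'B, rfl⟩ := hb
    apply hx₁nu
    have h1 : x₁ * b' = 1 := halg (by
      rw [map_mul, map_one]
      exact (congrArg Subtype.val hb1).symm)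
    exact IsUnit.of_mul_eq_one ⟨b', hb'B⟩ (Subtype.ext h1)
  -- a valuation subring of `L` dominating the localisation of `Bs` at a maximal ideal over `(x₁)`
  obtain ⟨V, hBV, hIV⟩ := Ideal.image_subset_nonunits_valuationSubring _ hI₁
  refine ⟨V.ValueGroup, inferInstance, V.valuation.comap alg, ?_, ?_, ?_, ?_⟩
  · -- trivial support: `V.valuation` is a valuation of a field and `alg` is injective
    rw [Valuation.comap_supp]
    have hsupp : V.valuation.supp = ⊥ := by
      ext x
      rw [Valuation.mem_supp_iff, Valuation.zero_iff, Ideal.mem_bot]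
    rw [hsupp]
    exact (RingHom.injective_iff_ker_eq_bot alg).mp halg
  · intro w hw
    rw [Valuation.comap_apply]
    exact (V.valuation_le_one_iff _).mpr (hBV ⟨_, hxB w hw, rfl⟩)
  · intro c
    rw [Valuation.comap_apply]
    exact (V.valuation_le_one_iff _).mpr (hBV ⟨_, hcB c, rfl⟩)
  · rw [Valuation.comap_apply]
    exact V.mem_nonunits_iff.mp (hIV ⟨⟨alg x₁, hx₁Bs⟩, Ideal.subset_span rfl, rfl⟩)

end Summit.ResolutionOfSingularities.ResolutionOfSingularities.Theorems
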